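import Mathlib

/-!
# `SnSubsetDichotomy.HyperoctahedralSubsets`, line `spherical-rank-sieve` — RE-MATCHING (surgery, existence half)

Helper for crux `stmt-MatrixMultiplication-8305` (lead c1; memo `Cruxes/HyperoctahedralSubsets/LeadC1-PoorCore.md`
§5).  The bulk recursion for the matching lemma cuts a vertex set `P` out of the 3-edge-coloured cubic graph
`M₀ ∪ M₁ ∪ M₂` of three fixed-point-free involutions `μ c` of `Fin n` and needs `P` (and its complement) to
be hosts again.  This file constructs the RE-MATCHED host: if `|P|` is even there are fixed-point-free
involutions `μ' c` for which `P` is invariant and which agree with `μ c` at every vertex whose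
`μ c`-partner lies on the same side of the cut (`stub_rematch`).  Only the "scar" vertices (endpoints of cut
edges) get new partners, re-matched among themselves on their own side; the parity that makes this possible
is that a set invariant under a fixed-point-free involution has even size (`even_card_of_invariant`), so the
scars of each colour inside `P` are even in number iff `|P|` is, and the outside scars are their images.
Together with `stub_surgeryTransfer` (local triples of `μ'` avoiding the scars are local triples of `μ`) and
`stub_subhostTransport` (local triples of the sub-host on `P` extend to `Fin n`) this is the complete
plumbing of one surgery step. [folklore]
-/

-- the project's summit namespace `Summit.MatrixMultiplication.MatrixMultiplication` repeats a component by design (D-0022)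
set_option linter.dupNamespace false

namespace Summit.MatrixMultiplication.MatrixMultiplication.Theorems.HyperoctahedralSubsets

open Equiv Equiv.Perm Finset

namespace Rematch

variable {α : Type*} [DecidableEq α]

/-- A finite set invariant under a fixed-point-free involution has even cardinality. [folklore] -/
theorem even_card_of_invariant (σ : α → α) (hσ : ∀ v, σ (σ v) = v) (hf : ∀ v, σ v ≠ v) :
    ∀ (A : Finset α), (∀ v ∈ A, σ v ∈ A) → Even A.card := by
  intro A
  induction A using Finset.strongInduction with
  | H A ih =>
    intro hA
    rcases A.eq_empty_or_nonempty with rfl | ⟨v, hv⟩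
    · simp
    · have hσv : σ v ∈ A := hA v hv
      have hne : σ v ≠ v := hf v
      set A' := (A.erase v).erase (σ v) with hA'
      have hsub : A' ⊂ A := lt_of_le_of_lt (erase_subset _ _) (erase_ssubset hv)
      have hA'inv : ∀ u ∈ A', σ u ∈ A' := by
        intro u hu
        simp only [hA', mem_erase] at hu ⊢
        obtain ⟨hu1, hu2, hu3⟩ := hu
        refine ⟨fun h => hu2 ?_, fun h => hu1 ?_, hA u hu3⟩
        · have := congrArg σ h; rwa [hσ, hσ] at this
        · have := congrArg σ h; rwa [hσ] at this
      have hcard : A.card = A'.card + 2 := by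
        have h1 : (A.erase v).card + 1 = A.card := card_erase_add_one hv
        have h2 : A'.card + 1 = (A.erase v).card :=
          card_erase_add_one (mem_erase.2 ⟨hne, hσv⟩)
        omega
      rw [hcard]
      exact (ih A' hsub hA'inv).add (by decide)

/-- **An arbitrary perfect matching on an even set, as a self-map of the ambient type**: identity off `Z`,
an involution without fixed points on `Z`. [folklore] -/
theorem exists_matching_on (Z : Finset α) (hZ : Even Z.card) :
    ∃ m : α → α, (∀ v ∈ Z, m v ∈ Z) ∧ (∀ v ∈ Z, m (m v) = v) ∧ (∀ v ∈ Z, m v ≠ v) ∧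
      ∀ v ∉ Z, m v = v := by
  obtain ⟨a, ha⟩ := hZ
  -- the swap of the two halves of `Fin (a + a)`: an involution without fixed points
  set hs : Fin (a + a) ≃ Fin (a + a) :=
    finSumFinEquiv.symm.trans ((Equiv.sumComm (Fin a) (Fin a)).trans finSumFinEquiv) with hhs
  have hs_hs : ∀ x, hs (hs x) = x := fun x => by simp [hhs]
  have hs_ne : ∀ x, hs x ≠ x := by
    intro x h
    have h' := congrArg finSumFinEquiv.symm h
    simp only [hhs, Equiv.trans_apply, Equiv.symm_apply_apply] at h'
    cases hx : (finSumFinEquiv.symm x : Fin a ⊕ Fin a) with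
    | inl i => rw [hx] at h'; simp at h'
    | inr i => rw [hx] at h'; simp at h'
  set e : {v // v ∈ Z} ≃ Fin (a + a) := Z.equivFin.trans (finCongr ha) with he
  refine ⟨fun v => if hv : v ∈ Z then ((e.symm (hs (e ⟨v, hv⟩)) : {v // v ∈ Z}) : α) else v,
    ?_, ?_, ?_, ?_⟩
  · intro v hv
    simp only [dif_pos hv]
    exact (e.symm _).2
  · intro v hv
    have hm : ((e.symm (hs (e ⟨v, hv⟩)) : {v // v ∈ Z}) : α) ∈ Z := (e.symm _).2
    simp only [dif_pos hv, dif_pos hm]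
    have : (⟨((e.symm (hs (e ⟨v, hv⟩)) : {v // v ∈ Z}) : α), hm⟩ : {v // v ∈ Z}) =
        e.symm (hs (e ⟨v, hv⟩)) := Subtype.ext rfl
    rw [this, Equiv.apply_symm_apply, hs_hs, Equiv.symm_apply_apply]
  · intro v hv h
    simp only [dif_pos hv] at h
    have h' : e.symm (hs (e ⟨v, hv⟩)) = ⟨v, hv⟩ := Subtype.ext h
    have h'' := congrArg e h'
    rw [Equiv.apply_symm_apply] at h''
    exact hs_ne _ h''
  · intro v hv
    simp only [dif_neg hv]

/-- **Re-matching one colour.**  For a fixed-point-free involution `σ` and a set `P` of even size there is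
a fixed-point-free involution `σ'` preserving `P` that agrees with `σ` wherever `v` and `σ v` lie on the
same side of `P`. [folklore] -/
theorem exists_rematch_one [Fintype α] (σ : Perm α) (hσ : σ * σ = 1) (hf : ∀ v, σ v ≠ v)
    (P : Finset α) (hP : Even P.card) :
    ∃ σ' : Perm α, σ' * σ' = 1 ∧ (∀ v, σ' v ≠ v) ∧ (∀ v, σ' v ∈ P ↔ v ∈ P) ∧
      ∀ v, (v ∈ P ↔ σ v ∈ P) → σ' v = σ v := by
  have hσσ : ∀ v, σ (σ v) = v := fun v => by rw [← Perm.mul_apply, hσ, Perm.one_apply]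
  -- inside scars `Z` and outside scars `Z'`
  set Z : Finset α := P.filter fun v => σ v ∉ P with hZ
  set Z' : Finset α := univ.filter fun v => v ∉ P ∧ σ v ∈ P with hZ'
  -- parity
  have hevenA : Even (P.filter fun v => σ v ∈ P).card := by
    refine even_card_of_invariant σ hσσ hf _ fun v hv => ?_
    rw [mem_filter] at hv ⊢
    exact ⟨hv.2, by rw [hσσ]; exact hv.1⟩
  have hZeven : Even Z.card := by
    have hPZ : Even ((P.filter fun v => σ v ∈ P).card + Z.card) := by
      rw [hZ, Finset.card_filter_add_card_filter_not]
      exact hP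
    exact (Nat.even_add.1 hPZ).1 hevenA
  have hZ'eq : Z' = Z.image σ := by
    ext v
    simp only [hZ', hZ, mem_filter, mem_univ, true_and, mem_image]
    constructor
    · rintro ⟨h1, h2⟩
      exact ⟨σ v, ⟨h2, by rw [hσσ]; exact h1⟩, hσσ v⟩
    · rintro ⟨u, ⟨hu1, hu2⟩, rfl⟩
      exact ⟨hu2, by rw [hσσ]; exact hu1⟩
  have hZ'even : Even Z'.card := by
    rw [hZ'eq, card_image_of_injective _ σ.injective]
    exact hZeven
  obtain ⟨m, hmZ, hmm, hmne, hmoff⟩ := exists_matching_on Z hZeven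
  obtain ⟨m', hm'Z, hm'm', hm'ne, hm'off⟩ := exists_matching_on Z' hZ'even
  -- membership bookkeeping
  have memZ : ∀ v, v ∈ Z ↔ v ∈ P ∧ σ v ∉ P := fun v => by rw [hZ, mem_filter]
  have memZ' : ∀ v, v ∈ Z' ↔ v ∉ P ∧ σ v ∈ P := fun v => by simp [hZ']
  -- the re-matched map
  set g : α → α := fun v => if (v ∈ P ↔ σ v ∈ P) then σ v else if v ∈ P then m v else m' v
    with hg
  have gN : ∀ v, (v ∈ P ↔ σ v ∈ P) → g v = σ v := fun v h => by simp only [hg, if_pos h]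
  have gZ : ∀ v, v ∈ Z → g v = m v := fun v h => by
    obtain ⟨h1, h2⟩ := (memZ v).1 h
    have : ¬ (v ∈ P ↔ σ v ∈ P) := fun k => h2 (k.1 h1)
    simp only [hg, if_neg this, if_pos h1]
  have gZ' : ∀ v, v ∈ Z' → g v = m' v := fun v h => by
    obtain ⟨h1, h2⟩ := (memZ' v).1 h
    have : ¬ (v ∈ P ↔ σ v ∈ P) := fun k => h1 (k.2 h2)
    simp only [hg, if_neg this, if_neg h1]
  have cases3 : ∀ v, (v ∈ P ↔ σ v ∈ P) ∨ v ∈ Z ∨ v ∈ Z' := fun v => by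
    by_cases h : (v ∈ P ↔ σ v ∈ P)
    · exact Or.inl h
    · by_cases hv : v ∈ P
      · exact Or.inr (Or.inl ((memZ v).2 ⟨hv, fun k => h ⟨fun _ => k, fun _ => hv⟩⟩))
      · refine Or.inr (Or.inr ((memZ' v).2 ⟨hv, ?_⟩))
        by_contra k
        exact h ⟨fun a => absurd a hv, fun a => absurd a k⟩
  have hginv : Function.Involutive g := fun v => by
    rcases cases3 v with h | h | h
    · rw [gN v h, gN (σ v) (by rw [hσσ]; exact h.symm), hσσ]
    · rw [gZ v h, gZ (m v) (hmZ v h), hmm v h]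
    · rw [gZ' v h, gZ' (m' v) (hm'Z v h), hm'm' v h]
  refine ⟨hginv.toPerm g, ?_, ?_, ?_, ?_⟩
  · ext v; simp [hginv v]
  · intro v
    show g v ≠ v
    rcases cases3 v with h | h | h
    · rw [gN v h]; exact hf v
    · rw [gZ v h]; exact hmne v h
    · rw [gZ' v h]; exact hm'ne v h
  · intro v
    show g v ∈ P ↔ v ∈ P
    rcases cases3 v with h | h | h
    · rw [gN v h]; exact h.symm
    · rw [gZ v h]
      exact iff_of_true ((memZ _).1 (hmZ v h)).1 ((memZ v).1 h).1
    · rw [gZ' v h]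
      exact iff_of_false ((memZ' _).1 (hm'Z v h)).1 ((memZ' v).1 h).1
  · intro v h
    exact gN v h

end Rematch

open Rematch in
/-- **Re-matching after a cut** (crux `SnSubsetDichotomy.HyperoctahedralSubsets`, stmt-MatrixMultiplication-8305,
line `spherical-rank-sieve`).  Let `μ 0, μ 1, μ 2` be fixed-point-free involutions of `Fin n` and `P` a vertex
set of even size.  Then there are fixed-point-free involutions `μ' 0, μ' 1, μ' 2` of `Fin n` for which `P` is
invariant (`μ' c v ∈ P ↔ v ∈ P`) and which agree with `μ c` at every vertex `v` whose `μ c`-partner lies on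
the same side as `v` (`v ∈ P ↔ μ c v ∈ P`); i.e. only the endpoints of cut edges ("scars") are re-matched,
among themselves and on their own side.  With `stub_surgeryTransfer` and `stub_subhostTransport` this is one
complete surgery step of the bulk recursion.  Proof: `exists_rematch_one` colour by colour; the parity input is
that the non-scar part of `P` is invariant under the fixed-point-free involution `μ c`, hence even. [folklore] -/
theorem stub_rematch :
    ∀ (n : ℕ) (μ : Fin 3 → Equiv.Perm (Fin n)), (∀ c, μ c * μ c = 1 ∧ ∀ v, μ c v ≠ v) →
      ∀ (P : Finset (Fin n)), Even P.card →
        ∃ μ' : Fin 3 → Equiv.Perm (Fin n),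
          (∀ c, μ' c * μ' c = 1 ∧ ∀ v, μ' c v ≠ v) ∧ (∀ c v, μ' c v ∈ P ↔ v ∈ P) ∧
          (∀ c v, (v ∈ P ↔ μ c v ∈ P) → μ' c v = μ c v) := by
  intro n μ hμ P hP
  have h : ∀ c, ∃ σ' : Equiv.Perm (Fin n), σ' * σ' = 1 ∧ (∀ v, σ' v ≠ v) ∧
      (∀ v, σ' v ∈ P ↔ v ∈ P) ∧ ∀ v, (v ∈ P ↔ μ c v ∈ P) → σ' v = μ c v := fun c =>
    exists_rematch_one (μ c) (hμ c).1 (hμ c).2 P hP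
  choose μ' h1 h2 h3 h4 using h
  exact ⟨μ', fun c => ⟨h1 c, h2 c⟩, h3, h4⟩

end Summit.MatrixMultiplication.MatrixMultiplication.Theorems.HyperoctahedralSubsets
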